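import Summits.AtomisticToContinuum.BoseEinsteinCondensation.Theses.BECDyadicChaining
import Summits.AtomisticToContinuum.BoseEinsteinCondensation.Theorems.BECDyadicChainingDyadicCoherenceDefectLevelIncrement
import Summits.AtomisticToContinuum.BoseEinsteinCondensation.Theorems.BECDyadicChainingDyadicCoherenceDefectZeroScatteringEnergy
import Summits.AtomisticToContinuum.BoseEinsteinCondensation.Theorems.BECDyadicChainingDyadicCoherenceDefectFreeAssembly
import Summits.AtomisticToContinuum.BoseEinsteinCondensation.Theorems.BECDyadicChainingDyadicCoherenceDefectDefectPerturbation
import Summits.AtomisticToContinuum.BoseEinsteinCondensation.Theorems.BECDyadicChainingDyadicCoherenceDefectFreeDirichletGap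
import Summits.AtomisticToContinuum.BoseEinsteinCondensation.Theorems.BECDyadicChainingDyadicCoherenceDefectFreeDirichletEnergy
import Summits.AtomisticToContinuum.BoseEinsteinCondensation.Theorems.BECDyadicChainingDyadicCoherenceDefectBlockKineticBound
import Summits.AtomisticToContinuum.BoseEinsteinCondensation.Theorems.BECDyadicChainingDyadicCoherenceDefectKineticBudget
import Summits.AtomisticToContinuum.BoseEinsteinCondensation.Theorems.BECDyadicChainingDyadicCoherenceDefectKineticWindowBudget
import Summits.AtomisticToContinuum.BoseEinsteinCondensation.Theorems.BECDyadicChainingDyadicCoherenceDefectPowerLawSuffices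
import Summits.AtomisticToContinuum.BoseEinsteinCondensation.Theorems.BECDyadicChainingBaseCoherentMass
import Summits.AtomisticToContinuum.BoseEinsteinCondensation.Theorems.BECDyadicChainingAssembly
import HarnessLib

/-!
# Crux `DyadicCoherenceDefect` (stmt-AtomisticToContinuum-13192), line `registered`:
# the REDUCTION to the one open stub S1″, and the crux's place relative to the conjunct

Supports (does not close) stmt-AtomisticToContinuum-13192.

This file moves the sorry-free part of the lead's skeleton (`Cruxes/DyadicCoherenceDefect/Lines/registered.lean`,
leads c1–c3) into the theorem tree, so that it can be cited and composed:

1. `dyadicCoherenceDefect_of_haarBandAboveKineticWindow` — **the line's composition.** The expanded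
   signature of the registered stub S1″ (`stub_haarBandAboveKineticWindow`: Haar-band occupation of Dirichlet
   near-minimisers above the kinetic window `s > c₀(ρa)^{-1/2}`, one summable √-budget `Σβ ≤ b`,
   `10c₀ + b < 1/4`, positive scattering length) implies the route decl
   `BECDyadicChaining.DyadicCoherenceDefect` BY NAME. Every other piece is a landed theorem of this
   directory: the level ladder S2 (`stub_levelIncrement`), the free-gas half (`stub_freeAssembly` fed
   `stub_freeDirichletGap`, `stub_freeDirichletEnergy`, `stub_zeroScatteringEnergy`, `stub_defectPerturbation`:
   zero scattering length, all levels, every density, budget `≤ 1/8`), and the kinetic window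
   (`stub_kineticWindowBudget` fed S2, `stub_blockKineticBound`, `stub_kineticBudget`: the levels with
   `L/2^m ≤ c₀(ρa)^{-1/2}`, budget `16c₀√((1+μ)/π) < 10 c₀`). Glue: split on `a = 0` / `a > 0`; in the second
   case `ρ₀ = min`, `β = β¹ + β²`, eventualities intersected, `δ = min`, and per level the case split
   above / inside the window. A future proof of the S1″ signature therefore closes the crux by `exact`.
2. `dyadicCoherenceDefect_of_powerLawHaarBand` — the same from the power-law form P
   (`T_m − T_{m−1} ≤ ε (s_*/s_m)^α N` above `s_* = c₀(ρa)^{-1/2}`, `ε → 0` with the density), through the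
   landed glue `stub_powerLawSuffices`.
3. **Where the crux sits.** With `BaseCoherentMass` PROVED (`Theorems.baseCoherentMass_proof`,
   stmt-AtomisticToContinuum-13193) the route's landed glue and assembly give, unconditionally in everything but the crux,
   `zeroModeOccupation_of_dyadicCoherenceDefect : DyadicCoherenceDefect → ZeroModeOccupation` (X_B1,
   stmt-AtomisticToContinuum-0686, `c = 1/16`) and
   `boseEinsteinCondensation_of_dyadicCoherenceDefect : DyadicCoherenceDefect → BoseEinsteinCondensation`
   (the sub-problem statement, i.e. ground-state BEC of the dilute Bose gas in the thermodynamic limit,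
   LSSY2005 Ch. 5 — open). Composed with 1–2: the S1″ signature, and the power law P, each imply the conjunct.
   These are machine-checked LOWER BOUNDS ON THE DIFFICULTY of the open stub: S1″ is not a sub-problem of
   the crux but a reformulation of the conjunct, resolved scale by scale.

No analysis lives here; the file is bookkeeping over landed theorems (constants: `16/√π < 10`).

References: [LSSY2005] §1.2 (1.16)–(1.19), Ch. 5 (5.1)–(5.2), (5.15)–(5.17); [arXiv:2603.20776] Rem. 7
(one coarse-graining step pays `R²`; no engine above the window); [PenroseOnsager1956].
-/

noncomputable section

open Filter MeasureTheory
open scoped ENNReal NNReal BigOperators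

namespace Summit.AtomisticToContinuum.BoseEinsteinCondensation.Cruxes.DyadicCoherenceDefect.Birth

open Literature.MathematicalPhysics.QuantumManyBody.BoseGas
open Summit.AtomisticToContinuum.BoseEinsteinCondensation.Theses
open Summit.AtomisticToContinuum.BoseEinsteinCondensation.Theorems

namespace Reduction

/-- `16/√π < 10` (`π > 2.56`): the kinetic window's budget `16 c₀/√π` fits under S1″'s slack `10 c₀`.
[folklore] -/
theorem sixteen_div_sqrt_pi_lt_ten : 16 / Real.sqrt Real.pi < 10 := by
  have h16 : (8 / 5 : ℝ) < Real.sqrt Real.pi := by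
    refine (Real.lt_sqrt (by norm_num)).2 ?_
    nlinarith [Real.pi_gt_three]
  rw [div_lt_iff₀ (Real.sqrt_pos.2 Real.pi_pos)]
  linarith

end Reduction

open Reduction in
/-- **The line's composition: the crux from the one open stub S1″ (expanded signature).**
`HaarBandAboveKineticWindow → BECDyadicChaining.DyadicCoherenceDefect`: for `a = 0` the landed free-gas half
(`ℓ_d = 1`, every density, budget `≤ 1/8`); for `a > 0` the constants `c₀, b, ℓ_d` of S1″, the landed kinetic
window at `(c₀, 1/4 − b, ℓ_d)` (admissible since `16c₀/√π < 10c₀ < 1/4 − b`), `ρ₀ = min`, `β = β¹ + β²`,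
`δ = min`, and per level: above the window S1″ (T-form, turned into the defect by the landed ladder
`A_m ≤ A_{m-1} + √(T_m − T_{m-1})`), inside it the window budget. [cite: LSSY2005, §1.2 (1.17) and Ch. 5 (5.15)–(5.17)] -/
theorem dyadicCoherenceDefect_of_haarBandAboveKineticWindow :
    (∀ v : ℝ → ℝ≥0∞, IsRepulsiveFiniteRange v → 0 < scatteringLength v →
      ∃ c₀ b ℓd : ℝ, 0 < c₀ ∧ 0 ≤ b ∧ 10 * c₀ + b < 1 / 4 ∧ 0 < ℓd ∧
      ∃ ρ₀ : ℝ, 0 < ρ₀ ∧ ∀ ρ : ℝ, 0 < ρ → ρ < ρ₀ →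
        ∃ β : ℕ → ℝ, (∀ j, 0 ≤ β j) ∧ Summable β ∧ ∑' j, β j ≤ b ∧ ∀ᶠ N : ℕ in atTop,
          let a : ℝ := (scatteringLength v).toReal
          let L : ℝ := sideLength ρ N
          let φ : (m : ℕ) → (Fin 3 → Fin (2 ^ m)) → EuclideanSpace ℝ (Fin 3) → ℂ := fun m i =>
            Set.indicator {x : EuclideanSpace ℝ (Fin 3) | ∀ k : Fin 3, x k ∈
                Set.Ioo (((i k : ℕ) : ℝ) * (L / 2 ^ m)) ((((i k : ℕ) : ℝ) + 1) * (L / 2 ^ m))}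
              (fun _ => ((Real.sqrt ((L / 2 ^ m) ^ 3))⁻¹ : ℂ))
          ∃ δ : ℝ≥0∞, 0 < δ ∧ ∀ Ψ : TrialState N L, energy v Ψ ≤ groundStateEnergy v N L + δ →
            let T : ℕ → ℝ≥0∞ := fun m => ∑ i : Fin 3 → Fin (2 ^ m), occupation N (φ m i) Ψ.ψ
            ∀ m j : ℕ, 1 ≤ m → ℓd * 2 ^ j ≤ L / 2 ^ m → L / 2 ^ m < ℓd * 2 ^ (j + 1) →
              c₀ * (ρ * a) ^ (-(1 : ℝ) / 2) < L / 2 ^ m →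
              (T m - T (m - 1)) ^ (1 / 2 : ℝ) ≤ ENNReal.ofReal (β j) * (N : ℝ≥0∞) ^ (1 / 2 : ℝ)) →
    BECDyadicChaining.DyadicCoherenceDefect := by
  intro hH
  have hW := stub_kineticWindowBudget stub_levelIncrement stub_blockKineticBound stub_kineticBudget
  have hF := stub_freeAssembly stub_freeDirichletGap stub_freeDirichletEnergy stub_zeroScatteringEnergy
    stub_defectPerturbation
  intro v hv
  rcases eq_or_ne (scatteringLength v) 0 with h0 | hne
  · -- a = 0: the free gas, all levels, every density
    refine ⟨1, one_pos, 1, one_pos, fun ρ hρ _ => ?_⟩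
    obtain ⟨β, hβ0, hβs, hβt, E⟩ := hF v hv h0 1 one_pos ρ hρ
    refine ⟨β, hβ0, hβs, hβt.trans (by norm_num), ?_⟩
    filter_upwards [E] with N hN
    obtain ⟨δ, hδ, H⟩ := hN
    exact ⟨δ, hδ, fun Ψ hΨ m j hm hj1 hj2 => H Ψ hΨ m j hm hj1 hj2⟩
  · -- a > 0: S1″ above the kinetic window, the window budget inside it
    have ha : 0 < scatteringLength v := pos_iff_ne_zero.mpr hne
    obtain ⟨c₀, b, ℓd, hc₀, hb, hcb, hℓd, ρ₁, hρ₁, H1⟩ := hH v hv ha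
    have hb' : 16 * c₀ / Real.sqrt Real.pi < 1 / 4 - b := by
      have h1 : 16 * c₀ / Real.sqrt Real.pi = c₀ * (16 / Real.sqrt Real.pi) := by ring
      have h2 : c₀ * (16 / Real.sqrt Real.pi) < c₀ * 10 :=
        mul_lt_mul_of_pos_left sixteen_div_sqrt_pi_lt_ten hc₀
      rw [h1]
      linarith
    obtain ⟨ρ₂, hρ₂, H2⟩ := hW v hv ha c₀ hc₀ (1 / 4 - b) hb' ℓd hℓd
    refine ⟨ℓd, hℓd, min ρ₁ ρ₂, lt_min hρ₁ hρ₂, fun ρ hρ hρlt => ?_⟩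
    obtain ⟨β₁, hβ₁0, hβ₁s, hβ₁t, E1⟩ := H1 ρ hρ (hρlt.trans_le (min_le_left _ _))
    obtain ⟨β₂, hβ₂0, hβ₂s, hβ₂t, E2⟩ := H2 ρ hρ (hρlt.trans_le (min_le_right _ _))
    refine ⟨fun j => β₁ j + β₂ j, fun j => add_nonneg (hβ₁0 j) (hβ₂0 j), hβ₁s.add hβ₂s, ?_, ?_⟩
    · show ∑' j, (β₁ j + β₂ j) ≤ 1 / 4
      rw [hβ₁s.tsum_add hβ₂s]
      linarith
    filter_upwards [E1, E2] with N hN1 hN2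
    obtain ⟨δ₁, hδ₁, HΨ1⟩ := hN1
    obtain ⟨δ₂, hδ₂, HΨ2⟩ := hN2
    refine ⟨min δ₁ δ₂, lt_min hδ₁ hδ₂, fun Ψ hΨ => ?_⟩
    have h1 := HΨ1 Ψ (hΨ.trans (add_le_add le_rfl (min_le_left _ _)))
    have h2 := HΨ2 Ψ (hΨ.trans (add_le_add le_rfl (min_le_right _ _)))
    intro A m j hm hj1 hj2
    rcases lt_or_ge (c₀ * (ρ * (scatteringLength v).toReal) ^ (-(1 : ℝ) / 2))
        (sideLength ρ N / 2 ^ m) with hup | hin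
    · have hT := h1 m j hm hj1 hj2 hup
      have hI := (stub_levelIncrement N (sideLength ρ N) Ψ m hm).2.2
      exact (hI.trans (add_le_add le_rfl hT)).trans (add_le_add le_rfl (mul_le_mul'
        (ENNReal.ofReal_le_ofReal (le_add_of_nonneg_right (hβ₂0 j))) le_rfl))
    · exact (h2 m j hm hj1 hj2 hin).trans (add_le_add le_rfl (mul_le_mul'
        (ENNReal.ofReal_le_ofReal (le_add_of_nonneg_left (hβ₁0 j))) le_rfl))

/-- **The crux from the power-law Haar band P** (expanded signature), through the landed glue
`stub_powerLawSuffices : P → S1″` and the composition. [folklore] -/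
theorem dyadicCoherenceDefect_of_powerLawHaarBand
    (hP :
      ∀ v : ℝ → ℝ≥0∞, IsRepulsiveFiniteRange v → 0 < scatteringLength v →
        ∃ c₀ α : ℝ, 0 < c₀ ∧ c₀ ≤ 1 / 50 ∧ 0 < α ∧ ∀ ε : ℝ, 0 < ε →
        ∃ ρ₀ : ℝ, 0 < ρ₀ ∧ ∀ ρ : ℝ, 0 < ρ → ρ < ρ₀ → ∀ᶠ N : ℕ in atTop,
          let a : ℝ := (scatteringLength v).toReal
          let L : ℝ := sideLength ρ N
          let φ : (m : ℕ) → (Fin 3 → Fin (2 ^ m)) → EuclideanSpace ℝ (Fin 3) → ℂ := fun m i =>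
            Set.indicator {x : EuclideanSpace ℝ (Fin 3) | ∀ k : Fin 3, x k ∈
                Set.Ioo (((i k : ℕ) : ℝ) * (L / 2 ^ m)) ((((i k : ℕ) : ℝ) + 1) * (L / 2 ^ m))}
              (fun _ => ((Real.sqrt ((L / 2 ^ m) ^ 3))⁻¹ : ℂ))
          ∃ δ : ℝ≥0∞, 0 < δ ∧ ∀ Ψ : TrialState N L, energy v Ψ ≤ groundStateEnergy v N L + δ →
            let T : ℕ → ℝ≥0∞ := fun m => ∑ i : Fin 3 → Fin (2 ^ m), occupation N (φ m i) Ψ.ψ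
            ∀ m : ℕ, 1 ≤ m → c₀ * (ρ * a) ^ (-(1 : ℝ) / 2) < L / 2 ^ m →
              T m - T (m - 1) ≤
                ENNReal.ofReal (ε * (c₀ * (ρ * a) ^ (-(1 : ℝ) / 2) / (L / 2 ^ m)) ^ α * N)) :
    BECDyadicChaining.DyadicCoherenceDefect :=
  dyadicCoherenceDefect_of_haarBandAboveKineticWindow (stub_powerLawSuffices hP)

/-! ## Where the crux sits: it implies the route target and the sub-problem statement

`BaseCoherentMass` is a theorem (`baseCoherentMass_proof`), so the route's landed glue
(`zeroModeOfChaining_proof`) and assembly (`becDyadicChaining_assembly_proof`) need only the crux. -/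

/-- **Crux ⇒ route target.** `DyadicCoherenceDefect → ZeroModeOccupation` (X_B1, stmt-AtomisticToContinuum-0686,
flat-mode occupation `≥ N/16` for near-minimisers at small density): the landed glue fed the proved
`BaseCoherentMass`. [folklore] -/
theorem zeroModeOccupation_of_dyadicCoherenceDefect (hD : BECDyadicChaining.DyadicCoherenceDefect) :
    BECDyadicChaining.ZeroModeOccupation :=
  zeroModeOfChaining_proof hD baseCoherentMass_proof

/-- **Crux ⇒ conjunct.** `DyadicCoherenceDefect → BoseEinsteinCondensation` (ground-state BEC of the dilute
three-dimensional Bose gas in the thermodynamic limit, the sub-problem statement): the landed assembly fed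
the proved `BaseCoherentMass`. So the crux is at least as hard as the conjunct it serves.
[cite: LSSY2005, §1.2 (1.19) and Ch. 5 (5.1)–(5.2)] -/
theorem boseEinsteinCondensation_of_dyadicCoherenceDefect (hD : BECDyadicChaining.DyadicCoherenceDefect) :
    _root_.BoseEinsteinCondensation :=
  becDyadicChaining_assembly_proof hD baseCoherentMass_proof

/-- **Open stub ⇒ conjunct.** The expanded signature of the registered stub S1″
(`stub_haarBandAboveKineticWindow`) implies `BoseEinsteinCondensation`: composition, then crux ⇒ conjunct.
A kernel-checked lower bound on the stub's difficulty. [cite: LSSY2005, Ch. 5 (5.1)–(5.2)] -/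
theorem boseEinsteinCondensation_of_haarBandAboveKineticWindow
    (hH :
      ∀ v : ℝ → ℝ≥0∞, IsRepulsiveFiniteRange v → 0 < scatteringLength v →
        ∃ c₀ b ℓd : ℝ, 0 < c₀ ∧ 0 ≤ b ∧ 10 * c₀ + b < 1 / 4 ∧ 0 < ℓd ∧
        ∃ ρ₀ : ℝ, 0 < ρ₀ ∧ ∀ ρ : ℝ, 0 < ρ → ρ < ρ₀ →
          ∃ β : ℕ → ℝ, (∀ j, 0 ≤ β j) ∧ Summable β ∧ ∑' j, β j ≤ b ∧ ∀ᶠ N : ℕ in atTop,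
            let a : ℝ := (scatteringLength v).toReal
            let L : ℝ := sideLength ρ N
            let φ : (m : ℕ) → (Fin 3 → Fin (2 ^ m)) → EuclideanSpace ℝ (Fin 3) → ℂ := fun m i =>
              Set.indicator {x : EuclideanSpace ℝ (Fin 3) | ∀ k : Fin 3, x k ∈
                  Set.Ioo (((i k : ℕ) : ℝ) * (L / 2 ^ m)) ((((i k : ℕ) : ℝ) + 1) * (L / 2 ^ m))}
                (fun _ => ((Real.sqrt ((L / 2 ^ m) ^ 3))⁻¹ : ℂ))
            ∃ δ : ℝ≥0∞, 0 < δ ∧ ∀ Ψ : TrialState N L, energy v Ψ ≤ groundStateEnergy v N L + δ →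
              let T : ℕ → ℝ≥0∞ := fun m => ∑ i : Fin 3 → Fin (2 ^ m), occupation N (φ m i) Ψ.ψ
              ∀ m j : ℕ, 1 ≤ m → ℓd * 2 ^ j ≤ L / 2 ^ m → L / 2 ^ m < ℓd * 2 ^ (j + 1) →
                c₀ * (ρ * a) ^ (-(1 : ℝ) / 2) < L / 2 ^ m →
                (T m - T (m - 1)) ^ (1 / 2 : ℝ) ≤ ENNReal.ofReal (β j) * (N : ℝ≥0∞) ^ (1 / 2 : ℝ) ) :
    _root_.BoseEinsteinCondensation :=
  boseEinsteinCondensation_of_dyadicCoherenceDefect (dyadicCoherenceDefect_of_haarBandAboveKineticWindow hH)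

/-- **Power law ⇒ conjunct.** The power-law Haar band P implies `BoseEinsteinCondensation`. [cite: LSSY2005, Ch. 5 (5.1)–(5.2)] -/
theorem boseEinsteinCondensation_of_powerLawHaarBand
    (hP :
      ∀ v : ℝ → ℝ≥0∞, IsRepulsiveFiniteRange v → 0 < scatteringLength v →
        ∃ c₀ α : ℝ, 0 < c₀ ∧ c₀ ≤ 1 / 50 ∧ 0 < α ∧ ∀ ε : ℝ, 0 < ε →
        ∃ ρ₀ : ℝ, 0 < ρ₀ ∧ ∀ ρ : ℝ, 0 < ρ → ρ < ρ₀ → ∀ᶠ N : ℕ in atTop,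
          let a : ℝ := (scatteringLength v).toReal
          let L : ℝ := sideLength ρ N
          let φ : (m : ℕ) → (Fin 3 → Fin (2 ^ m)) → EuclideanSpace ℝ (Fin 3) → ℂ := fun m i =>
            Set.indicator {x : EuclideanSpace ℝ (Fin 3) | ∀ k : Fin 3, x k ∈
                Set.Ioo (((i k : ℕ) : ℝ) * (L / 2 ^ m)) ((((i k : ℕ) : ℝ) + 1) * (L / 2 ^ m))}
              (fun _ => ((Real.sqrt ((L / 2 ^ m) ^ 3))⁻¹ : ℂ))
          ∃ δ : ℝ≥0∞, 0 < δ ∧ ∀ Ψ : TrialState N L, energy v Ψ ≤ groundStateEnergy v N L + δ →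
            let T : ℕ → ℝ≥0∞ := fun m => ∑ i : Fin 3 → Fin (2 ^ m), occupation N (φ m i) Ψ.ψ
            ∀ m : ℕ, 1 ≤ m → c₀ * (ρ * a) ^ (-(1 : ℝ) / 2) < L / 2 ^ m →
              T m - T (m - 1) ≤
                ENNReal.ofReal (ε * (c₀ * (ρ * a) ^ (-(1 : ℝ) / 2) / (L / 2 ^ m)) ^ α * N)) :
    _root_.BoseEinsteinCondensation :=
  boseEinsteinCondensation_of_dyadicCoherenceDefect (dyadicCoherenceDefect_of_powerLawHaarBand hP)

end Summit.AtomisticToContinuum.BoseEinsteinCondensation.Cruxes.DyadicCoherenceDefect.Birth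

end
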